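import Summits.AtomisticToContinuum.Crystallization.Theorems.FrustratedLawDichotomyTwoShellRigidityGaugedLadderD
import Summits.AtomisticToContinuum.Crystallization.Theorems.OverbindingBudgetTwoShellCover

/-!
# FrustratedLawDichotomy · two-shell rigidity — the LEAST-SQUARES-GAUGED ENTRY node beneath `M⁺ = CappedRigidityBoth(At)`
# (decomp-a2c, lens 3 «one certified translation + split beneath», gen 33; slot 3 of `OverbindingBudgetTwoShellShape`)

The only inputs still open below `TwoShellShape (1/100) (3/50) (1/450)` (slot 3) are the two capped-cluster statements
`CappedRigidityBothAt (1/100) η₁ η₂ Pat`, `Pat ∈ {fcc, hcp}`, `η₁, η₂ ≤ 3/50` (finite mirror `CappedCertBoth`).  The tree already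
holds the TERMINAL of the gauged-ladder route (`…GaugedLadderC.cappedRigidityBothAt_of_gEntry`, `gEntryAt_of_gChain`,
`gChainAt_of_rungLPChain`, `…GaugedLadderD.coversProbes26`), but its ENTRY is typed through an ungauged entry plus ONE re-gauging
(`GEntryAt … (noGauge _) P₀`, `RegaugeAt … P₀ P`), and the only re-gauging tool (`regaugeAt_of_gaugeFix`, `κ = √6`) inflates an entry
by `×(1+√6)ρ ≈ 3.9` — circular at `θ = 1/100` (lens-3 g32/g33 memos).

THIS NODE types the entry DIRECTLY IN THE LEAST-SQUARES GAUGE and splits it: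

  `CappedRigidityBothAt (1/100) (ρ·Q.1) (ρ·Q.2.1) Pat ⟸ LsEntryAt Pat P ∧ GLadderCert26At Pat P L Q`      (`cappedRigidityBothAt_of_lsEntry`, proved)

with `LsEntryAt Pat P := GEntryAt Pat probes26 (lsGauge Pat) (1/100) P` [INSTRUMENTABLE — the braced branch-and-bound of the accepted
12-direction `Rig` engine + per-leaf «regauge» linear-target certificates; spec = g33/MEMO.md §2–§4], itself planned as

  `LsEntryAt Pat P ⟸ CapBrace β (1/100) Pat ∧ ProcrustesGauge Pat ∧ ⟨braced Rig run with ls-entry leaf goals = true⟩ ∧ CapAprioriAt (tree)`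

where `CapBrace` [ATTACKABLE·S — the octahedral cell lemma sharpened from the tree's `22θ` (`…OctaCoeffs.octa_diag_coords`) to `≤ 5.7θ`,
or a 6-point LP certificate; measured need `β ≤ 1/10`, first-order truth `3θ`] and `ProcrustesGauge` [ANALYTIC·M, Mathlib-only: a
least-squares-optimal isometry exists and satisfies the gauge equation `Σ u × (B⁻¹ p_u − u) = 0`] are DEFINED here so that the census /
hand seats have exact targets.  Measurements deciding the constants (g33/MEMO.md §0): with `β = 1/20` the brace kills every accepted `Rig`
leaf with `|t| ≥ 0.12` (fcc) / `0.10` (hcp) and the ls-gauged first-order entry over the surviving leaves is `P ≈ (0.075, 0.21, 0.11, 0.29)`,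
inside the certified-contracting region of lens-5's ladder (`K = 12` runs, both patterns; fixed points `ρ·Q = (0.0315, 0.044)` fcc,
`(0.0314, 0.0444)` hcp `< 3/50`).

Contents: §1 the three definitions; §2 the proved glue at one pattern, at both patterns (`CappedRigidityBoth`, with monotonicity in
`(η₁, η₂)`), and the slot-3 reading `TwoShellShapeV (1/100) (3/50) (1/450)` through `OverbindingBudgetTwoShellCover.twoShellShapeV_of_G_P_Mboth`.
No `sorry`, no new axioms, no `instance`/`notation`.
-/

noncomputable section

namespace Summit.AtomisticToContinuum.Crystallization.Theorems.FrustratedLawDichotomyTwoShellRigidityLsEntry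

open Literature.Geometry.DiscreteGeometry
open Summit.AtomisticToContinuum.Crystallization.Theorems.FrustratedLawDichotomyTwoShellRigidityCut
open Summit.AtomisticToContinuum.Crystallization.Theorems.FrustratedLawDichotomyTwoShellRigidityCells
open Summit.AtomisticToContinuum.Crystallization.Theorems.FrustratedLawDichotomyTwoShellRigidityGaugedLadder
open Summit.AtomisticToContinuum.Crystallization.Theorems.OverbindingBudgetTwoShellSeam (TwoShellShapeV)
open Summit.AtomisticToContinuum.Crystallization.Theorems.OverbindingBudgetTwoShellCover (twoShellShapeV_of_G_P_Mboth)
open scoped RealInnerProductSpace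

/-! ## §1 The pieces of the entry (definitions = exact targets) -/

/-- **D · `CapBrace β θ Pat`** — the cap brace: in every injective `7/10`-separated configuration whose link at `i` is `Pat`-isomorphic
via `τ` and capped, the two link vectors of every `√2`-pair (a square diagonal of the pattern) have cosine of absolute value `≤ β`.
[candidate · ATTACKABLE·S: the octahedral cell (centre, cap, four square vertices; twelve window edges, diagonals `≥ nn`, non-contact strictness);
first-order truth `|cos| ≤ 3θ`; the route needs `β ≤ 1/10` at `θ = 1/100`.] -/
def CapBrace (β θ : ℝ) (Pat : Finset E3) : Prop :=
  ∀ (N : ℕ) (y : Fin N → E3) (i : Fin N) (τ : ↥Pat → Fin N), Function.Injective y →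
    (∀ a b : Fin N, a ≠ b → (7 : ℝ) / 10 ≤ dist (y a) (y b)) → LinkIso θ Pat y i τ → Capped θ Pat y i τ →
      ∀ u v : ↥Pat, dist (u : E3) (v : E3) = Real.sqrt 2 →
        |⟪y (τ u) - y i, y (τ v) - y i⟫| ≤ β * (‖y (τ u) - y i‖ * ‖y (τ v) - y i‖)

/-- **PG · `ProcrustesGauge Pat`** — the least-squares (orthogonal Procrustes) gauge is attainable: for every vector field `p` on the
pattern there is a linear isometry `B` minimising `Σ_u ‖B⁻¹ (p u) − u‖²` over all linear isometries, and every such minimiser has its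
residual field in the least-squares gauge `lsGauge Pat` (`Σ_u u × (B⁻¹ (p u) − u) = 0`, the first-order condition along rotations).
[ANALYTIC·M, Mathlib-only: compactness of the isometry group of `ℝ³` + differentiation along a rotation curve; pattern-independent.] -/
def ProcrustesGauge (Pat : Finset E3) : Prop :=
  ∀ p : ↥Pat → E3, ∃ B : E3 ≃ₗᵢ[ℝ] E3,
    (∀ B' : E3 ≃ₗᵢ[ℝ] E3, ∑ u : ↥Pat, ‖B.symm (p u) - (u : E3)‖ ^ 2 ≤ ∑ u : ↥Pat, ‖B'.symm (p u) - (u : E3)‖ ^ 2) ∧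
    lsGauge Pat (fun u => B.symm (p u) - (u : E3))

/-- **B · `LsEntryAt Pat P`** — THE CERTIFIED ENTRY in the ladder's own currency: a `26`-probe directional fit of tolerance
`P = (shell, caps, contacts, cap−vertex)` IN THE LEAST-SQUARES GAUGE at `θ = 1/100`.  [INSTRUMENTABLE: braced `Rig` branch-and-bound
whose leaves end in linear-target certificates for the re-gauged residual functionals; g33/MEMO.md §2–§4.] -/
def LsEntryAt (Pat : Finset E3) (P : ℝ × ℝ × ℝ × ℝ) : Prop :=
  GEntryAt Pat probes26 (lsGauge Pat) (1 / 100) P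

/-! ## §2 The glue, proved -/

/-- Monotonicity of `M⁺` in its two tolerances. [folklore] -/
theorem cappedRigidityBothAt_mono {θ η₁ η₂ η₁' η₂' : ℝ} {Pat : Finset E3} (h1 : η₁ ≤ η₁') (h2 : η₂ ≤ η₂')
    (h : CappedRigidityBothAt θ η₁ η₂ Pat) : CappedRigidityBothAt θ η₁' η₂' Pat := by
  intro N y i τ hy hsep hL hC
  obtain ⟨A, hA1, hA2⟩ := h N y i τ hy hsep hL hC
  have hr : 0 ≤ nearestDist y i := nearestDist_nonneg y i
  refine ⟨A, fun u => (hA1 u).trans (mul_le_mul_of_nonneg_right h1 hr), fun u v m huv hmi hb => ?_⟩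
  exact (hA2 u v m huv hmi hb).trans (mul_le_mul_of_nonneg_right h2 hr)

/-- ★ **The node at one pattern**: a least-squares-gauged `26`-probe entry of tolerance `P` and a `GLadderCert26At` chain `P → … → Q`
give `M⁺` at `Pat` with `(η₁, η₂) = (1.1281·Q.1, 1.1281·Q.2.1)`. [folklore chaining of `…GaugedLadderC/D`] -/
theorem cappedRigidityBothAt_of_lsEntry {Pat : Finset E3} {P Q : ℝ × ℝ × ℝ × ℝ} {L : List (ℝ × ℝ × ℝ × ℝ)}
    (h1 : ∀ z ∈ Pat, ‖z‖ = 1) (hE : LsEntryAt Pat P) (hL : GLadderCert26At Pat P L Q) :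
    CappedRigidityBothAt (1 / 100) (11281 / 10000 * Q.1) (11281 / 10000 * Q.2.1) Pat :=
  cappedRigidityBothAt_of_gEntry (by norm_num) coversProbes26
    (gEntryAt_of_gChain hE (gChainAt_of_rungLPChain h1 (by norm_num) (by norm_num) coversProbes26 L hL))

/-- ★ at fcc. -/
theorem cappedRigidityBothAt_fcc_of_lsEntry {P Q : ℝ × ℝ × ℝ × ℝ} {L : List (ℝ × ℝ × ℝ × ℝ)}
    (hE : LsEntryAt fccKissingPattern P) (hL : GLadderCert26At fccKissingPattern P L Q) :
    CappedRigidityBothAt (1 / 100) (11281 / 10000 * Q.1) (11281 / 10000 * Q.2.1) fccKissingPattern :=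
  cappedRigidityBothAt_of_lsEntry (fun _ hz => norm_eq_one_of_mem_fccKissingPattern hz) hE hL

/-- ★ at hcp. -/
theorem cappedRigidityBothAt_hcp_of_lsEntry {P Q : ℝ × ℝ × ℝ × ℝ} {L : List (ℝ × ℝ × ℝ × ℝ)}
    (hE : LsEntryAt hcpKissingPattern P) (hL : GLadderCert26At hcpKissingPattern P L Q) :
    CappedRigidityBothAt (1 / 100) (11281 / 10000 * Q.1) (11281 / 10000 * Q.2.1) hcpKissingPattern :=
  cappedRigidityBothAt_of_lsEntry (fun _ hz => norm_eq_one_of_mem_hcpKissingPattern hz) hE hL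

/-- ★★ **`M⁺ = CappedRigidityBoth (1/100) η₁ η₂`** from, per pattern, an ls-gauged entry and a ladder chain, and the terminal arithmetic
`1.1281·Q.1 ≤ η₁`, `1.1281·Q.2.1 ≤ η₂` at both patterns. [folklore chaining] -/
theorem cappedRigidityBoth_of_lsEntries {η₁ η₂ : ℝ} {Pf Qf Ph Qh : ℝ × ℝ × ℝ × ℝ} {Lf Lh : List (ℝ × ℝ × ℝ × ℝ)}
    (hEf : LsEntryAt fccKissingPattern Pf) (hCf : GLadderCert26At fccKissingPattern Pf Lf Qf)
    (hf1 : 11281 / 10000 * Qf.1 ≤ η₁) (hf2 : 11281 / 10000 * Qf.2.1 ≤ η₂)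
    (hEh : LsEntryAt hcpKissingPattern Ph) (hCh : GLadderCert26At hcpKissingPattern Ph Lh Qh)
    (hh1 : 11281 / 10000 * Qh.1 ≤ η₁) (hh2 : 11281 / 10000 * Qh.2.1 ≤ η₂) : CappedRigidityBoth (1 / 100) η₁ η₂ :=
  ⟨cappedRigidityBothAt_mono hf1 hf2 (cappedRigidityBothAt_fcc_of_lsEntry hEf hCf),
    cappedRigidityBothAt_mono hh1 hh2 (cappedRigidityBothAt_hcp_of_lsEntry hEh hCh)⟩

/-- ★★★ **Slot 3 in the config-level currency**: `G = LinkClassification (1/100)` (landed: `…LinkCertOfCap.linkClassification_hundredth`),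
`P = CapForcing (1/100)` (hand-1 g17, `…CapForcingHundredth`), per pattern an ls-gauged entry + a ladder chain with
`1.1281·Q.1 ≤ 3/50`, `1.1281·Q.2.1 ≤ 3/50` ⟹ `TwoShellShapeV (1/100) (3/50) (1/450)`. [folklore chaining through
`OverbindingBudgetTwoShellCover.twoShellShapeV_of_G_P_Mboth`] -/
theorem twoShellShapeV_of_lsEntries {Pf Qf Ph Qh : ℝ × ℝ × ℝ × ℝ} {Lf Lh : List (ℝ × ℝ × ℝ × ℝ)}
    (hG : LinkClassification (1 / 100)) (hP : CapForcing (1 / 100))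
    (hEf : LsEntryAt fccKissingPattern Pf) (hCf : GLadderCert26At fccKissingPattern Pf Lf Qf)
    (hf1 : 11281 / 10000 * Qf.1 ≤ 3 / 50) (hf2 : 11281 / 10000 * Qf.2.1 ≤ 3 / 50)
    (hEh : LsEntryAt hcpKissingPattern Ph) (hCh : GLadderCert26At hcpKissingPattern Ph Lh Qh)
    (hh1 : 11281 / 10000 * Qh.1 ≤ 3 / 50) (hh2 : 11281 / 10000 * Qh.2.1 ≤ 3 / 50) :
    TwoShellShapeV (1 / 100) (3 / 50) (1 / 450) :=
  twoShellShapeV_of_G_P_Mboth le_rfl le_rfl hG hP (cappedRigidityBoth_of_lsEntries hEf hCf hf1 hf2 hEh hCh hh1 hh2)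

end Summit.AtomisticToContinuum.Crystallization.Theorems.FrustratedLawDichotomyTwoShellRigidityLsEntry

end
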